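import Summits.CriticalPhenomena.PercolationContinuityZ3.Theses.PercNearOneGluing
import Summits.CriticalPhenomena.PercolationContinuityZ3.Theorems.PercNearOneGluingNoHeavyLowerTailMonotoneCoverBound
import Literature.Probability.Percolation.PercolationProofs

/-!
# Crux `PercNearOneGluing.NoHeavyLowerTail` (stmt-CriticalPhenomena-4575), line `bhk-superadditivity-thinning` —
# the residual follows from CHEAP MONOTONE COVERS (typed next target for the selection-cost route)

Lead `prover-line-stmt-CriticalPhenomena-4575-0`, 2026-08-16; lands with `--supports stmt-CriticalPhenomena-4575`.
Combines the landed `monotoneCoverBound` (p80788: Kozma–Nitzan Thm 4 through an admissible pocket selection +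
Harris on a monotone set-valued cover) with the residual's event: if for every `ε` there is `δ` such that every
pairwise `δ`-reliable instance (hub `a₀ ∈ A`, observer `o ∉ A`, `P(o ↮ A) ≤ δ`) admits an admissible selection
`sel` and a monotone cover `Sel ∋ sel` of total price `Σ_a P(a ∈ Sel(pocket))·P(a ↮ a₀) ≤ ε` ("cheap monotone
cover", the hypothesis), then the line's residual `stub_manyFingersLargePocket` holds (with `d₀ = 0`, `s₀ = 1`),
hence the crux (`noHeavyLowerTail_of_manyFingersLargePocket`, p76496).  The cheap-cover statement is the purely
combinatorial form of the selection cost isolated by this line (lead notes Cruxes/NoHeavyLowerTail/NOTES.md §3–5;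
certified numerics: price ≤ 2.11 on every family computed, forced full covers unbounded).
-/

namespace Summit.CriticalPhenomena.PercolationContinuityZ3.Theorems

open scoped Classical BigOperators
open MeasureTheory Set
open Literature.Probability.LatticeModels (prodBernoulli)
open Literature.Probability.Percolation (openConn openConnIn BondConfig measurableSet_openConn_holds)

/-- **Cheap monotone covers imply the many-finger large-pocket residual.**  Given `ε`, take `δ` from
the cover hypothesis; for an instance, the residual event (`o ↮ a₀`, `1 ≤ N'`, …) lies in
`{o ↔ A} ∩ {o ↮ a₀}`, whose probability `monotoneCoverBound` bounds by the cover price `≤ ε`. -/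
theorem manyFingersLargePocket_of_cheapMonotoneCover :
    (∀ ε : ℝ, 0 < ε → ∃ δ : ℝ, 0 < δ ∧ ∀ (n : ℕ) (w : Sym2 (Fin n) → unitInterval) (A : Finset (Fin
      n)) (o a₀ : Fin n), a₀ ∈ A → o ∉ A → (∀ a ∈ A, ∀ a' ∈ A,
      (Literature.Probability.LatticeModels.prodBernoulli w).real
      (Literature.Probability.Percolation.openConn a a')ᶜ ≤ δ) →
      (Literature.Probability.LatticeModels.prodBernoulli w).real (⋃ a ∈ A,
      Literature.Probability.Percolation.openConn o a)ᶜ ≤ δ → ∃ (sel : Finset (Fin n) → Fin n) (Sel :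
      Finset (Fin n) → Finset (Fin n)), (∀ S₀ S₁ : Finset (Fin n), S₀ ⊆ S₁ → Sel S₀ ⊆ Sel S₁) ∧ (∀ S₀
      : Finset (Fin n), sel S₀ ∈ Sel S₀) ∧ (∀ S₀ : Finset (Fin n), o ∈ S₀ → Disjoint S₀ A → ∀ v ∈ A,
      (∃ x ∈ S₀, w s(x, v) ≠ 0) → (Literature.Probability.LatticeModels.prodBernoulli
      (Literature.Probability.Percolation.pinW w (Literature.Probability.Percolation.edgesTouching
      (↑S₀ : Set (Fin n))) (∅ : Set (Sym2 (Fin n))))).real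
      (Literature.Probability.Percolation.openConn (sel S₀) a₀) ≤
      (Literature.Probability.LatticeModels.prodBernoulli (Literature.Probability.Percolation.pinW w
      (Literature.Probability.Percolation.edgesTouching (↑S₀ : Set (Fin n))) (∅ : Set (Sym2 (Fin
      n))))).real (Literature.Probability.Percolation.openConn v a₀)) ∧ ∑ a : Fin n,
      (Literature.Probability.LatticeModels.prodBernoulli w).real {ω | a ∈ Sel (Finset.univ.filter fun
      v => ω ∈ Literature.Probability.Percolation.openConnIn (↑A : Set (Fin n))ᶜ o v)} *
      (Literature.Probability.LatticeModels.prodBernoulli w).real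
      (Literature.Probability.Percolation.openConn a a₀)ᶜ ≤ ε) → (∀ ε : ℝ, 0 < ε → ∃ (δ : ℝ) (d₀ s₀ :
      ℕ), 0 < δ ∧ ∀ (n : ℕ) (w : Sym2 (Fin n) → unitInterval) (A : Finset (Fin n)) (o a₀ : Fin n), a₀
      ∈ A → o ∉ A → (∀ a ∈ A, ∀ a' ∈ A, (Literature.Probability.LatticeModels.prodBernoulli w).real
      (Literature.Probability.Percolation.openConn a a')ᶜ ≤ δ) →
      (Literature.Probability.LatticeModels.prodBernoulli w).real (⋃ a ∈ A,
      Literature.Probability.Percolation.openConn o a)ᶜ ≤ δ →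
      (Literature.Probability.LatticeModels.prodBernoulli w).real {ω :
      Literature.Probability.Percolation.BondConfig (Fin n) | ω ∉
      Literature.Probability.Percolation.openConn o a₀ ∧ s₀ ≤ ((A.erase a₀).filter fun a => ω ∈
      Literature.Probability.Percolation.openConn o a).card ∧ 2 * ((A.erase a₀).filter fun a => ω ∈
      Literature.Probability.Percolation.openConn o a).card ≤ A.card ∧ d₀ < (A.filter fun a => ω ∈
      Literature.Probability.Percolation.openConnIn ((↑A : Set (Fin n))ᶜ ∪ {o, a}) o a).card} ≤ ε) := by
  intro hC ε hε
  obtain ⟨δ, hδ, h⟩ := hC ε hε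
  refine ⟨δ, 0, 1, hδ, fun n w A o a₀ ha₀ ho hpair hobs => ?_⟩
  obtain ⟨sel, Sel, hmono, hsel, hadm, hsum⟩ := h n w A o a₀ ha₀ ho hpair hobs
  have key := monotoneCoverBound n w A o a₀ sel Sel ho ha₀ hmono hsel hadm
  calc (prodBernoulli w).real {ω : BondConfig (Fin n) | ω ∉ openConn o a₀ ∧
            1 ≤ ((A.erase a₀).filter fun a => ω ∈ openConn o a).card ∧
            2 * ((A.erase a₀).filter fun a => ω ∈ openConn o a).card ≤ A.card ∧
            0 < (A.filter fun a => ω ∈ openConnIn ((↑A : Set (Fin n))ᶜ ∪ {o, a}) o a).card}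
        ≤ (prodBernoulli w).real ((⋃ a ∈ A, openConn o a) ∩ (openConn o a₀)ᶜ) := by
          refine measureReal_mono ?_
          rintro ω ⟨h1, h2, -, -⟩
          obtain ⟨a, ha⟩ := Finset.card_pos.mp h2
          rw [Finset.mem_filter] at ha
          exact ⟨Set.mem_iUnion₂.2 ⟨a, Finset.mem_of_mem_erase ha.1, ha.2⟩, h1⟩
    _ ≤ ∑ a : Fin n, (prodBernoulli w).real
          {ω | a ∈ Sel (Finset.univ.filter fun v => ω ∈ openConnIn (↑A : Set (Fin n))ᶜ o v)} *
            (prodBernoulli w).real (openConn a a₀)ᶜ := key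
    _ ≤ ε := hsum

end Summit.CriticalPhenomena.PercolationContinuityZ3.Theorems
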